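import Mathlib

/-! # Route CapacityClassicality — weight floor 1 ≤ k (stub for crux stmt-Langlands-8927, line Sketch)

The hypotheses of the crux `EigenIntegralOverconvergentIsClassical` — a `q`-expansion
`Σ σ₀ (a n) qⁿ` with algebraic-integer coefficients `a n`, normalised by `a 1 = 1`, which is an
exact `T_ℓ`-eigenvector (in `q`-expansion form, with nebentypus `ψ` mod `N` and weight `k ∈ ℤ`)
for every prime `ℓ ∤ N p` — already force `1 ≤ k`, so that the case `k ≤ 0` of the crux is
vacuous.  Proof: take a prime `ℓ > N p`; the `T_ℓ`-relation at `n = ℓ` reads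
`σ₀ (a ℓ²) + ψ ℓ · ℓ^(k-1) = σ₀ (a ℓ)²`, so `z := ψ ℓ · ℓ^(k-1)` is an algebraic integer; as
`ψ ℓ` is a root of unity (`ℓ` is a unit mod `N`), `(ℓ^(k-1))^φ(N) = z^φ(N)` is integral, hence so
is `ℓ^(k-1)`.  If `k ≤ 0` this is the rational number `1 / ℓ^(1-k) ∈ (0, 1)`, which is not an
integer, contradicting that `ℤ` is integrally closed.
-/

set_option linter.dupNamespace false -- `Summit.Langlands.Langlands` is the mandated namespace

namespace Summit.Langlands.Langlands.Theorems.CapacityClassicality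

/-- **Weight floor.** Under the hypotheses of the crux `EigenIntegralOverconvergentIsClassical`
(algebraic-integer coefficients `a n` with `a 1 = 1`, exact `T_ℓ`-eigenness in `q`-expansion form
for every prime `ℓ ∤ N p`, nebentypus `ψ` mod `N`, weight `k ∈ ℤ`) one has `1 ≤ k`.  Proof: for a
prime `ℓ > N p` the relation at `n = ℓ` shows that `ψ ℓ · ℓ^(k-1) = σ₀ (a ℓ)² - σ₀ (a ℓ²)` is an
algebraic integer; `ψ ℓ` is a `φ(N)`-th root of unity, so `ℓ^(k-1)` is an algebraic integer, which
for `k ≤ 0` is the non-integral rational `1 / ℓ^(1-k)` — impossible as `ℤ` is integrally closed.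
The hypotheses `5 ≤ p` and `p ∤ N` are part of the crux signature and are not used. [folklore] -/
theorem one_le_weight (N p : ℕ) [NeZero N] (hp : p.Prime) (hp5 : 5 ≤ p) (hN : ¬ p ∣ N)
    (k : ℤ) (E : Type) [Field E] [NumberField E] (σ₀ : E →+* ℂ) (a : ℕ → E)
    (ψ : DirichletCharacter ℂ N) (h1 : a 1 = 1) (hint : ∀ n, IsIntegral ℤ (a n))
    (hT : ∀ ℓ n : ℕ, ℓ.Prime → ¬ ℓ ∣ N * p → 0 < n →
      σ₀ (a (ℓ * n)) + (if ℓ ∣ n then ψ ℓ * (ℓ : ℂ) ^ (k - 1) * σ₀ (a (n / ℓ)) else 0)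
        = σ₀ (a ℓ) * σ₀ (a n)) :
    1 ≤ k := by
  -- `hp5` and `hN` belong to the crux signature but play no role here.
  have := hp5
  have := hN
  -- A prime `ℓ > N p`; in particular `ℓ ∤ N p` and `ℓ` is a unit mod `N`.
  obtain ⟨ℓ, hℓle, hℓ⟩ := Nat.exists_infinite_primes (N * p + 1)
  have hNp : 0 < N * p := Nat.mul_pos (NeZero.pos N) hp.pos
  have hℓNp : ¬ ℓ ∣ N * p := fun h => by
    have := Nat.le_of_dvd hNp h
    omega
  have hcop : Nat.Coprime ℓ N :=
    (Nat.Prime.coprime_iff_not_dvd hℓ).2 fun h => hℓNp (h.mul_right p)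
  -- The `T_ℓ`-relation at `n = ℓ`: `σ₀ (a ℓ²) + ψ ℓ ℓ^(k-1) = σ₀ (a ℓ)²`.
  have hrel := hT ℓ ℓ hℓ hℓNp hℓ.pos
  rw [if_pos dvd_rfl, Nat.div_self hℓ.pos, h1, map_one, mul_one] at hrel
  -- Hence `z := ψ ℓ ℓ^(k-1)` is an algebraic integer.
  have hz : IsIntegral ℤ (ψ ℓ * (ℓ : ℂ) ^ (k - 1)) := by
    have e : ψ ℓ * (ℓ : ℂ) ^ (k - 1) = σ₀ (a ℓ) * σ₀ (a ℓ) - σ₀ (a (ℓ * ℓ)) := by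
      rw [← hrel]
      ring
    rw [e]
    exact ((map_isIntegral_int σ₀ (hint ℓ)).mul (map_isIntegral_int σ₀ (hint ℓ))).sub
      (map_isIntegral_int σ₀ (hint _))
  -- `ψ ℓ` is a `φ(N)`-th root of unity, since `ℓ` is a unit mod `N`.
  have hψ : (ψ ℓ) ^ Nat.totient N = 1 := by
    rw [← ZMod.coe_unitOfCoprime ℓ hcop, ← map_pow, ← Units.val_pow_eq_pow_val, ZMod.pow_totient,
      Units.val_one, map_one]
  -- Therefore `ℓ^(k-1)` is an algebraic integer: its `φ(N)`-th power is `z^φ(N)`.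
  have hx : IsIntegral ℤ ((ℓ : ℂ) ^ (k - 1)) := by
    refine IsIntegral.of_pow (Nat.totient_pos.mpr (NeZero.pos N)) ?_
    have e : ((ℓ : ℂ) ^ (k - 1)) ^ Nat.totient N = (ψ ℓ * (ℓ : ℂ) ^ (k - 1)) ^ Nat.totient N := by
      rw [mul_pow, hψ, one_mul]
    rw [e]
    exact hz.pow _
  -- Suppose `k ≤ 0`, and write `k - 1 = -(j + 1)` with `j : ℕ`.
  by_contra hk
  rw [not_le] at hk
  obtain ⟨j, hj⟩ := Int.eq_ofNat_of_zero_le (show (0 : ℤ) ≤ -k by omega)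
  have e : (ℓ : ℂ) ^ (k - 1) = ((ℓ : ℂ) ^ (j + 1))⁻¹ := by
    rw [show k - 1 = -((j + 1 : ℕ) : ℤ) by push_cast; omega, zpow_neg, zpow_natCast]
  -- The rational number `1 / ℓ^(j+1)` is then integral over `ℤ`, hence an integer `m` ...
  have hq : IsIntegral ℤ (((ℓ : ℚ) ^ (j + 1))⁻¹) := by
    rw [← isIntegral_algebraMap_iff (algebraMap ℚ ℂ).injective, map_inv₀, map_pow, map_natCast,
      ← e]
    exact hx
  obtain ⟨m, hm⟩ := (IsIntegrallyClosed.isIntegral_iff (R := ℤ) (K := ℚ)).1 hq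
  rw [eq_intCast] at hm
  -- ... lying strictly between `0` and `1`: contradiction.
  have h1lt : (1 : ℚ) < (ℓ : ℚ) ^ (j + 1) :=
    one_lt_pow₀ (by exact_mod_cast hℓ.one_lt) (Nat.succ_ne_zero j)
  have hpos : (0 : ℚ) < ((ℓ : ℚ) ^ (j + 1))⁻¹ := inv_pos.mpr (zero_lt_one.trans h1lt)
  have hlt1 : ((ℓ : ℚ) ^ (j + 1))⁻¹ < 1 := inv_lt_one_of_one_lt₀ h1lt
  rw [← hm] at hpos hlt1
  have h0m : 0 < m := by exact_mod_cast hpos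
  have hm1 : m < 1 := by exact_mod_cast hlt1
  omega

/-- **Weight floor**, under the name registered for the stub of line `Sketch`
(crux `stmt-Langlands-8927`): verbatim restatement of `one_le_weight` — the crux hypotheses
force `1 ≤ k`. [folklore] -/
theorem stub_one_le_weight (N p : ℕ) [NeZero N] (hp : p.Prime) (hp5 : 5 ≤ p) (hN : ¬ p ∣ N)
    (k : ℤ) (E : Type) [Field E] [NumberField E] (σ₀ : E →+* ℂ) (a : ℕ → E)
    (ψ : DirichletCharacter ℂ N) (h1 : a 1 = 1) (hint : ∀ n, IsIntegral ℤ (a n))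
    (hT : ∀ ℓ n : ℕ, ℓ.Prime → ¬ ℓ ∣ N * p → 0 < n →
      σ₀ (a (ℓ * n)) + (if ℓ ∣ n then ψ ℓ * (ℓ : ℂ) ^ (k - 1) * σ₀ (a (n / ℓ)) else 0)
        = σ₀ (a ℓ) * σ₀ (a n)) :
    1 ≤ k :=
  one_le_weight N p hp hp5 hN k E σ₀ a ψ h1 hint hT

end Summit.Langlands.Langlands.Theorems.CapacityClassicality
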